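import Summits.ResolutionOfSingularities.ResolutionOfSingularities.Theorems.DeepCrossCutCells
import Summits.ResolutionOfSingularities.ResolutionOfSingularities.Theorems.MaxOrderAtomClasses
import Literature.AlgebraicGeometry.Resolution.HironakaTauScheme
import Literature.AlgebraicGeometry.Resolution.BlowupSequences
import Literature.AlgebraicGeometry.Resolution.MarkedIdeals
import Literature.AlgebraicGeometry.Resolution.StalkSpecializesLocalization
import Mathlib.Algebra.CharP.Defs
import Mathlib.Algebra.CharP.Lemmas
import Mathlib.Data.Nat.Multiplicity
import Mathlib.AlgebraicGeometry.Morphisms.Smooth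
import HarnessLib

/-!
# OddCrossCutKernels — decomp-res node «OddCrossCut» (lens-2 g23), file 1/2 of `OddCrossCutKernels`

[WRITER NOTE (decomp-res writer g11).  Content VERBATIM from the decomp-res lens-2 g23 node
`HOME/decomp-res-lens-2/g23/OddCrossCut.lean` (pin aae59dc8, 6 388 l; HOME = run/shared/lean/pub/decomp-res);
CRITIC-LEDGER row 184 CLEARED ((X***) `OddCrossExit` DECIDED-MOD-PORT(M+) +1 · MAP 0: residue-characteristic ≠ 2
deep crosses typed as a CLASS WITH TAILS + the odd guard; exit package decided on paper to cn27 standard by ODD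
DOMINATION; exact re-location of `IsDeepSpecialPt`); landing orders NEXT-g24 §Landing + critic rider INBOX :970:
ONLY the NEW part §Z (node lines 5511–6388) is landed — the node's CARRIED copies of g14–g22 (lines 306–4942,
4991–5507; ns `…Theses.OddCrossCut`) are NOT landed (DELETE-on-landing: they ARE the tree modules
PinchCut/JetCut/PurityCut/SplitCut/CylinderCut/SpreadCut/CrossCut/DeepCrossCut*, opened here instead); namespace
`…Theses.OddCrossCut` ↦ `…Theorems.OddCrossCut`; all files `--kind proof --supports
stmt-ResolutionOfSingularities-29273` (the ring-kernel file as helper).  Farm (node, critic re-farm): rc 0 · 0 err ·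
0 warn · 0 sorry · axioms std.  The lens header is kept verbatim below.]

# OddCrossCut — LAW (X***): THE DEEP CROSS IN ODD (≠ 2) RESIDUE CHARACTERISTIC, DECIDED BY ODD DOMINATION (critic window g23,
# CRITIC-LEDGER row 180 (d‴) — «residue characteristic ≠ 2 deep crosses as a typed CLASS WITH TAILS (the complement
the guard pushed into the
# residual; inhabitant = the 𝔽₃ datum `Y = 𝔸⁴_{𝔽₃}`, `I = (z² + u₁⁵ + v²u₂⁷, v²u₂⁸)`, certified in row 175): an exit
package decided to cn27 standard
# on paper or in kernel, with exact re-location of `IsDeepSpecialPt` — +1 ONCE (LESSON 6: the class decision must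
cover every residue
# characteristic it types, or guard again honestly)»).
PLACEMENT.  (d‴) is met ON PAPER for the typed class `IsUniformOddCross` = rev ≤ 7's twelve clauses
(`IsDeepCrossDatum`) + the ODD GUARD
`∀ x ∈ T, ¬ ringChar κ(x) ∣ 2·gcd(2q+1, d)`; LESSON 6 is honoured by construction: the one step of the proof that
depends on the residue
characteristic beyond `≠ 2` (the secondary multi-section `Γ_v` over the steep branch, §Z.1 EXIT (d)) is EXACTLY what
the second half of the
guard excludes, and the doubly divisible residue characteristics (`p` odd, `p ∣ m`, `p ∣ d`) are guarded OUT,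
honestly, into the located
residual `IsOddSpecialPt` — by complement, and that complement IS INHABITED with 𝒫(m,d) FAILING to exit there: the
CORNER CERTIFICATE
§Z.0c (`corner39`: `(q,d) = (1,9)` over `𝔽₃`, `τ = 1` at one point over `C₁ ∖ C₂` at the stop; kernels
`corner39_deepCrossNewtShape`,
`corner39_steepPairShape`, `corner39_chart`, `corner39_initialForm`), so the guard's second half is NECESSARY for
odd domination and not an
artefact of its proof (whether another package exits there is booked: NEXT-g24 (α)).  The inhabitant of row 175 is IN the class
(`(q,d) = (2,7)`, `gcd(5,7) = 1`, `3 ∤ 2`: `oddGuard_two_seven_at_three`, `oddGuard_of_three_eq_zero`,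
`deepCrossNewtShape_oddX3`).  NOT met:
a KERNEL proof of (X***) — `OddCrossExit` stays a hypothesis of the kernels (tag DECIDED (paper) · KERNEL PORT OPEN
= (X**)'s port:
LEMMA Y.C scheme-level, (T5), bed ⇒ engine; nothing new is owed by (X***) beyond (X**)'s port except the odd reading
§Z.1 (b)–(e), whose
algebra is in kernel: `crossTerm_coeff`, `oddReading_line/point`, `tail_deg_ge_three(_line)`, `dvd_two_of_dvd_deltaFun`,
`dvd_of_dvd_deltaFunC`, `deltaFun_hray_neighbour`).

## §Z.1 (X***)  ENGINE `OddCrossExit` — DECIDED (paper) by ODD DOMINATION for every odd `3 ≤ m ≤ d` and every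
residue characteristic
## `p ∤ 2·gcd(m,d)` (`p = 0` included) · KERNEL PORT OPEN (= (X**)'s) · the 𝔽₃ DATUM's run = INSEP-vv7's nine centres

DATA (`IsUniformOddCross I 2 q d η₁ η₂`, §Z.2): EXACTLY the data of (X**) §Y.1 — marking `2`; `m = 2q+1 ≤ d`, `d`
odd; `T = C₁ ∪ C₂` the
closures of two distinct curve points meeting, `T` = the order-`2` locus near `T`; at each tangle point `y ∈ C₁ ∩
C₂` the NEWTON-TYPED deep
letter `f = Q·z² + ε₁u₁^m + ε₂v²u₂^d + g`, members in `deepNewt`; the STEEP-PAIR letter along `C₁ ∖ C₂`, the FLANK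
letter (`μ̄` a
uniformiser of `𝒪_{C₂,y‴}`) along `C₂ ∖ C₁` — with the characteristic-`2` guard of rev8 REPLACED by the ODD GUARD.
Dictionary with LEMMA
Y.C: `(x, y, t) = (u₁, u₂, v)`, `A = (m,0,0)`, `B = (0,d,2)`, `δ_v = ⟨A − B, v⟩` (`deltaFun`), `C₁ = V(z,x,y)` (the
`t`-axis), `C₂ = V(z,x,t)`.
PRELIMINARY (the only use of `2 ∈ 𝒪_{Y,y}×` on the letters): complete the square in `z` — replace `z` by `z +
h/(2Q)` where `z·h` is the
`z`-linear part of the tail.  This keeps every clause: the tail cone `deepWt` and the member ideal `deepNewt` are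
cut out by LINEAR weights
whose threshold is the weight of the corner `z²`, so `wt(h²) = 2·wt(h) ≥ threshold + 2` and the correction `h²/(4Q)`
is again a tail; and
every `z`-linear tail monomial is a multiple of `u₁` or of `u₂v` (a bare `z·v^b` or `z·u₂^e` violates `W₂ ≥ 2q+1`
resp. `W₁ ≥ 2m+1`), so `h`
vanishes on `T` and `(z + h/(2Q), u₁, u₂)`, `(z + h/(2Q), u₁, v)` still cut out the branches.  Likewise along `C₁ ∖
C₂` and `C₂ ∖ C₁`.
Henceforth NO `z`-LINEAR TERMS; `z^{≥3}`-tail terms have order `≥ 3` after every controlled transform and never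
enter an initial form.

THE DECISION — ODD DOMINATION.  Let 𝒫(m,d) be ANY S3′ run on the bed member `z² + x^m + t²y^d` in the
characteristic-`2` READING of LEMMA
Y.C (§Y.1 (X**): state = the unimodular fan `Σ_j` of accumulated divisors with the discounts `c_v`; moves (P1) =
saturate a new ray,
(P2)/(P3)/(P3n) = star-subdivide an edge `{v,w}`; it TERMINATES — (T4) TERMINATION THEOREM, kernel `Fan.wellFounded_P2Step` +
`Fan.run_sound` of g22's `FanGame.lean`, and (T2) PEEL LEMMA — and STOPS exactly when `Σ` has no unreduced ray over
`T`, no special line over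
`T`, no special cone over `T`, no nodal edge (Y.C (v), `Fan.Exit`); for definiteness the lexicographic run of
`explore/combi.py` = `Fan.run`).
𝒫(m,d) is a finite COMBINATORIAL datum of `(m,d)`: a list of centres, each a ray `v` (a top PLANE, taken
`⌊min(⟨A,v⟩,⟨B,v⟩)/2⌋` times at the
ray's creation) or an edge `{v,w}` of the current fan with its IMAGE TYPE — over the tangle (`supp(v+w) = {x,y,t}`),
dominating `C₁`
(`supp = {x,y}`), dominating `C₂` (`supp = {x,t}`).  TRANSPORT to `(Y, I)` in the odd class: perform the same list
of blow-ups, the `j`-th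
centre being THE UNIQUE IRREDUCIBLE COMPONENT `Γ_j` OF `Top_j(T)` (the order-`2` locus of the `j`-th controlled
transform lying over `T`)
of the prescribed dimension (`2` for a plane, `1` for an edge), the prescribed image type (over each tangle point
`y` in turn for the
fibre strata — `T` has finitely many tangle points and their games are isomorphic copies played simultaneously —,
dominating `C₁`, or
dominating `C₂`) and the prescribed EXCEPTIONAL INCIDENCE: contained in `E_v` and `E_w` (both rays exceptional), in
`E_v` and in no other
exceptional divisor (one ray exceptional), in no exceptional divisor (the branches `C₁ = {e_x,e_y}`, `C₂ =
{e_x,e_t}` themselves and their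
strict transforms).  No coordinate hyperplane is ever named: the strata `{v, e_t}` with `v` over `C₁` are the fibres
`E_v ∩ π_j⁻¹(y)`
(`t` uniformises `C₁` at `y`), `{v, e_y}` with `v` over `C₂` likewise, the sections `{v, e_x}`, `{v, e_y}` over `C₁`
and the boundary
curves `{v, e_k}` of a divisor over `y` are singled out by «in `E_v` and in no other exceptional divisor» —
UNIQUELY, by this NAMING LEMMA (proof): (1) two exceptional rays: the centre IS `E_v ∩ E_w ∩ Top_j` — one irreducible
curve, since a point of `E_v ∩ E_w` with `Z ≠ 0` has order `0` (the constant `Q·Z(P)²`, (f)) and all of `E_v ∩ E_w ∩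
{Z = 0}` has order
`min(|a|,|b|) ≥ 2` ((b)(ii)); a top plane IS `E_v ∩ Top_j = E_v ∩ {Z = 0}`; (2) no exceptional ray: the strict
transform of `C_i` = the
closure of `Top_j ∖ (exceptional locus)` over `C_i`; (3) one exceptional ray `v` (image prescribed): the candidates
inside `E_v` are the
coordinate strata `{v, e_k}` and the secondary curve `Γ_v`, and (P1) SATURATION gives `min(a_v, b_v) ≤ 1`, so at
most one of «`b_v ≥ 2`:
`{v,e_x}` top», «`a_v ≥ 2`: `{v,e_y}`, `{v,e_t}` top», «`(a_v,b_v) = (1,1)`: `Γ_v`» holds ((b)(ii): `{v,e_x}` has `a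
= (a_v, m)`, `b = (b_v, 0)`;
`{v,e_y}` has `a = (a_v, 0)`; `{v,e_t}` has `a = (a_v,0)`, `b = (b_v,2)`); `{v,e_y}` and `{v,e_t}` have different
images unless `supp v =
{x,y,t}`, and NO full-support ray is ever adjacent to `e_y`: the FIRST centre of every 𝒫(m,d) is `C₁ = {e_x,e_y}`
(special of order `m ≥ 3`,
beating `C₂`'s order `2`), after which `e_y` lies in the single cone `{e_x+e_y, e_y, e_t}`, none of whose edges is
ever top (`|a| = 1, 1`,
order `0`) — a frozen cone.  So the key (dimension, image, set of exceptional divisors) names at most one component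
of `Top_j(T)` at every
stage, for every member of the class (corroborated by instrument on all 130 runs `m ≤ 21`, `m ≤ d ≤ m + 24`,
`explore/oddcheck.py`: 0 clashes;

[… the lens header continues (88 more lines: the (X***) paper decision §Z.1 in full, the data dictionary, the 𝔽₃ datum run and
what (X***) does not decide) in the HOME node file `HOME/decomp-res-lens-2/g23/OddCrossCut.lean` lines 1–283 and
NODE-g23.md — not repeated here.]

## This file

§Z.0 (NEW, ring level; `section OddRing` / `OddInhabitant` / `OddCorner`) — the ODD READING in kernel: the guard
functionals `deltaFun` / `deltaFunC` (`dvd_two_of_dvd_deltaFun`, `dvd_of_dvd_deltaFunC`,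
`deltaFun_hray(_neighbour)`), the cross-term lemma `crossTerm_coeff`, tails and pairs (`tail_deg_ge_three(_line)`,
`IsPairZ`, `oddReading_*`, `oddSpecial_*`, `tail_ne_pair`, `deltaFun_not_zero_on_basis`); the 𝔽₃ INHABITANT of
window (d‴) at ring level (`oddX3f/g`, `oddX3`, `deepFrame3`, `represent_*`, `deepCrossNewtShape_oddX3`,
`oddX3_le_sq_*`, `ringChar_zmod_three`, `oddGuard_*`); §Z.0c the CORNER CERTIFICATE `corner39_*` (the doubly
divisible complement of the odd guard IS inhabited and 𝒫(3,9) does not exit there), `pairTail_le_pairWt`,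
`three_eq_zero_of_charP`.  Over the tree's `DeepCrossCutKernels2` (`deepWt` / `deepNewt` / `pairWt`, `monomial_mem_*`).

Part 1/2 carries: `deltaFun`, `dvd_two_of_dvd_deltaFun`, `deltaFunC`, `dvd_of_dvd_deltaFunC`, `deltaFun_hray`,
`deltaFun_hray_neighbour`, `tail_deg_ge_three`, `tail_deg_ge_three_line`, `crossTerm_coeff`, `IsPairZ`,
`oddReading_line`, `oddSpecial_line_is_special`, `oddReading_point`, `oddSpecial_point_is_special`, `tail_ne_pair`,
`deltaFun_not_zero_on_basis`, `oddX3f`.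

(Sources: Hironaka1964 Ch. III; CossartJannsenSaito2020 Ch. 2, Ch. 8–9; CossartPiltant2008 Prop. 4.2;
CossartPiltant2019 Rem. 3.2; BierstoneGrigorievMilmanWlodarczyk2011 §3.1; Moh1987; Hauser2010Kangaroo; Giraud1975;
Narasimhan1983.)
-/

open CategoryTheory AlgebraicGeometry TopologicalSpace IsLocalRing
open Literature.AlgebraicGeometry.Resolution
open Summit.ResolutionOfSingularities.ResolutionOfSingularities.Theorems
open Summit.ResolutionOfSingularities.ResolutionOfSingularities.Theorems.WeakOrderReduction
open Summit.ResolutionOfSingularities.ResolutionOfSingularities.Theorems.DeltaFaceCutClasses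
open Summit.ResolutionOfSingularities.ResolutionOfSingularities.Theorems.RelativeDeltaCut
open Summit.ResolutionOfSingularities.ResolutionOfSingularities.Theorems.CurveLeafExit
open Summit.ResolutionOfSingularities.ResolutionOfSingularities.Theorems.DeepCrossCut
open Summit.ResolutionOfSingularities.ResolutionOfSingularities.Theorems.PinchCut
open Summit.ResolutionOfSingularities.ResolutionOfSingularities.Theorems.JetCut
open Summit.ResolutionOfSingularities.ResolutionOfSingularities.Theorems.PurityCut
open Summit.ResolutionOfSingularities.ResolutionOfSingularities.Theorems.SplitCut
open Summit.ResolutionOfSingularities.ResolutionOfSingularities.Theorems.CylinderCut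
open Summit.ResolutionOfSingularities.ResolutionOfSingularities.Theorems.SpreadCut
open Summit.ResolutionOfSingularities.ResolutionOfSingularities.Theorems.CrossCut
open Summit.ResolutionOfSingularities.ResolutionOfSingularities.Theorems.DeepCrossCut
open MvPolynomial

namespace Summit.ResolutionOfSingularities.ResolutionOfSingularities.Theorems.OddCrossCut

section OddRing

variable {R : Type} [CommRing R]

/-! ### §Z.0  ring level — the ODD READING (the cross-term lemma, the tail/pair bookkeeping, the two guard
functionals), the `𝔽₃`
INHABITANT of window (d‴) at the ring level, and (§Z.0c) the CORNER CERTIFICATE (the guard's complement is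
inhabited; 𝒫 fails there) -/

/-- **THE δ-FUNCTIONAL OF THE BED** [g23] (`deltaFun m d v = m·v_x − d·v_y − 2·v_t`, `v = (v_x, v_y, v_t) ∈ ℤ³` a
valuation vector /
ray of the fan of (X**)): `δ_v = ord_{D_v}(x^A) − ord_{D_v}(x^B)`, `A = (m,0,0)`, `B = (0,d,2)`.  DEFINITION
(support, bookkeeping). [folklore] -/
def deltaFun (m d : ℤ) (v : ℤ × ℤ × ℤ) : ℤ := m * v.1 - d * v.2.1 - 2 * v.2.2

/-- **THE ODD GUARD OVER A TANGLE POINT IS AUTOMATIC** [g23; KERNEL (PROVED)] (ODD LEMMA Z.C (iv)): if `p` divides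
`δ` on three rays
`v, w, z` in whose `ℤ`-span `e_t = (0,0,1)` lies (every cone of a unimodular fan), then `p ∣ 2` (`δ(e_t) = −2`).  So
in residue characteristic
`p ∤ 2` the pair `(δ_w, δ_z)` at an `H`-ray `v` (`δ_v = 0`) is never `≡ (0,0) (mod p)`: on a divisor `D_v` LYING
OVER THE TANGLE POINT (units
constant to first order) the secondary curve `Γ_v` has `τ = 3` at every point (Jacobian criterion on the torus
orbit), §Z.1 EXIT (c). [folklore] -/
theorem dvd_two_of_dvd_deltaFun (m d p : ℤ) (v w z : ℤ × ℤ × ℤ) (α β γ : ℤ)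
    (hx : α * v.1 + β * w.1 + γ * z.1 = 0) (hy : α * v.2.1 + β * w.2.1 + γ * z.2.1 = 0)
    (ht : α * v.2.2 + β * w.2.2 + γ * z.2.2 = 1)
    (hv : p ∣ deltaFun m d v) (hw : p ∣ deltaFun m d w) (hz : p ∣ deltaFun m d z) : p ∣ 2 := by
  have h : p ∣ α * deltaFun m d v + β * deltaFun m d w + γ * deltaFun m d z :=
    dvd_add (dvd_add (Dvd.dvd.mul_left hv α) (Dvd.dvd.mul_left hw β)) (Dvd.dvd.mul_left hz γ)
  have key : α * deltaFun m d v + β * deltaFun m d w + γ * deltaFun m d z = -2 := by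
    unfold deltaFun
    have e : α * (m * v.1 - d * v.2.1 - 2 * v.2.2) + β * (m * w.1 - d * w.2.1 - 2 * w.2.2) +
        γ * (m * z.1 - d * z.2.1 - 2 * z.2.2) =
        m * (α * v.1 + β * w.1 + γ * z.1) - d * (α * v.2.1 + β * w.2.1 + γ * z.2.1) -
          2 * (α * v.2.2 + β * w.2.2 + γ * z.2.2) := by ring
    rw [e, hx, hy, ht]; ring
  rw [key] at h
  exact (dvd_neg).mp h

/-- **THE TWISTED δ-FUNCTIONAL ALONG THE STEEP BRANCH** [g23] (`deltaFunC m d θ v = m·v_x − d·v_y + (θ − 2)·v_t`):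
on an exceptional
divisor `D_v` DOMINATING `C₁` the units of the letter vary along `C₁` (`t∘π = u_w^{w_t}·u_z^{z_t}` on the orbit),
and the logarithmic
differential of `ρ·u^{δ′}` (`ρ = ε₁/ε₂` restricted, `θ := t·ρ′/ρ` at the point) is `Σ_i (δ_i + θ·(v_i)_t) du_i/u_i` — the functional
`deltaFunC` in place of `deltaFun`.  DEFINITION (support, bookkeeping). [folklore] -/
def deltaFunC (m d θ : ℤ) (v : ℤ × ℤ × ℤ) : ℤ := m * v.1 - d * v.2.1 + (θ - 2) * v.2.2

/-- **WHERE THE ODD GUARD IS NEEDED** [g23; KERNEL (PROVED)] (ODD LEMMA Z.C (iv′)): if `p` divides the twisted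
functional on three rays
spanning `e_x` and `e_y`, then `p ∣ m` AND `p ∣ d`.  Contrapositively: in residue characteristic `p ∤ gcd(m, d)` the
secondary curve `Γ_v`
on a divisor dominating the steep branch keeps `τ = 3` at every point WHATEVER the units do; for `p ∣ m`, `p ∣ d`
(and `θ ≡ 2`) it need
not — the isolated `τ = 1` points of §Z.1 GUARD, whence the clause `¬ ringChar κ(x) ∣ 2·gcd(2q+1, d)` of
`IsUniformOddCross`. [folklore] -/
theorem dvd_of_dvd_deltaFunC (m d θ p : ℤ) (v w z : ℤ × ℤ × ℤ) (α β γ α' β' γ' : ℤ)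
    (hx : α * v.1 + β * w.1 + γ * z.1 = 1) (hy : α * v.2.1 + β * w.2.1 + γ * z.2.1 = 0)
    (ht : α * v.2.2 + β * w.2.2 + γ * z.2.2 = 0)
    (hx' : α' * v.1 + β' * w.1 + γ' * z.1 = 0) (hy' : α' * v.2.1 + β' * w.2.1 + γ' * z.2.1 = 1)
    (ht' : α' * v.2.2 + β' * w.2.2 + γ' * z.2.2 = 0)
    (hv : p ∣ deltaFunC m d θ v) (hw : p ∣ deltaFunC m d θ w) (hz : p ∣ deltaFunC m d θ z) : p ∣ m ∧ p ∣ d := by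
  have lin : ∀ a b c : ℤ, a * deltaFunC m d θ v + b * deltaFunC m d θ w + c * deltaFunC m d θ z =
      m * (a * v.1 + b * w.1 + c * z.1) - d * (a * v.2.1 + b * w.2.1 + c * z.2.1) +
        (θ - 2) * (a * v.2.2 + b * w.2.2 + c * z.2.2) := by
    intro a b c; unfold deltaFunC; ring
  have h1 : p ∣ α * deltaFunC m d θ v + β * deltaFunC m d θ w + γ * deltaFunC m d θ z :=
    dvd_add (dvd_add (Dvd.dvd.mul_left hv α) (Dvd.dvd.mul_left hw β)) (Dvd.dvd.mul_left hz γ)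
  have h2 : p ∣ α' * deltaFunC m d θ v + β' * deltaFunC m d θ w + γ' * deltaFunC m d θ z :=
    dvd_add (dvd_add (Dvd.dvd.mul_left hv α') (Dvd.dvd.mul_left hw β')) (Dvd.dvd.mul_left hz γ')
  rw [lin, hx, hy, ht] at h1
  rw [lin, hx', hy', ht'] at h2
  simp only [mul_one, mul_zero, sub_zero, add_zero] at h1 h2
  refine ⟨h1, ?_⟩
  have : p ∣ -d := by simpa using h2
  exact (dvd_neg).mp this

/-- **THE `H`-RAY OVER THE STEEP BRANCH** [g23; KERNEL (PROVED)]: with `g = gcd(m,d)`, `m = g·m′`, `d = g·d′`, the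
ray `(d′, m′, 0)` lies on
`H = {δ = 0}` (its divisor, when the 2-dimensional steep-pair game over `C₁ ∖ C₂` creates it — 83 of the 130 runs `m
≤ 21`, `d ≤ m + 24`,
`explore/oddcheck.py` — carries the secondary multi-section `Γ_v`). [folklore] -/
theorem deltaFun_hray (g m' d' : ℤ) : deltaFun (g * m') (g * d') (d', m', 0) = 0 := by
  unfold deltaFun; ring

/-- **ITS FACE NEIGHBOURS HAVE `δ = ±g`** [g23; KERNEL (PROVED)] (ODD LEMMA Z.C (iv′)): if `(d′, m′)` and `(w_x,
w_y)` form a basis of `ℤ²`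
then `δ(w_x, w_y, 0) = ∓g` — so the fibre component `δ_w·du_w/u_w` of `dφ` along `Γ_v` over `C₁ ∖ C₂` vanishes in residue
characteristic `p` iff `p ∣ g`: THE place of the guard `p ∤ gcd(m,d)`. [folklore] -/
theorem deltaFun_hray_neighbour (g m' d' wx wy : ℤ) (hdet : d' * wy - m' * wx = 1 ∨ d' * wy - m' * wx = -1) :
    deltaFun (g * m') (g * d') (wx, wy, 0) = -g ∨ deltaFun (g * m') (g * d') (wx, wy, 0) = g := by
  unfold deltaFun
  rcases hdet with h | h
  · left; linear_combination (-g) * h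
  · right; linear_combination (-g) * h

/-- **TAILS HAVE DEGREE ≥ 3 AT A CONE ORIGIN** [g23; KERNEL (PROVED)] ((T5) STEP 1 ⇒ every tail exponent `γ` has all
three coordinates
`≥ 1`): tails never reach the quadratic part `q(U)` of the initial form at a torus-fixed point. [folklore] -/
theorem tail_deg_ge_three (α₁ α₂ α₃ β₁ β₂ β₃ γ₁ γ₂ γ₃ : ℤ) (hα : 0 ≤ α₁ ∧ 0 ≤ α₂ ∧ 0 ≤ α₃) (hβ : 0 ≤ β₁ ∧ 0 ≤ β₂ ∧ 0 ≤ β₃)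
    (hγ : min α₁ β₁ + 1 ≤ γ₁ ∧ min α₂ β₂ + 1 ≤ γ₂ ∧ min α₃ β₃ + 1 ≤ γ₃) : 3 ≤ γ₁ + γ₂ + γ₃ := by
  omega

/-- **TAILS HAVE DEGREE ≥ 3 ALONG A PAIR LINE** [g23; KERNEL (PROVED)]: on the orbit of a top line `{v,w}` with `a =
(1,1)` (and `|b| ≥ 2`)
every tail monomial has `(u_v,u_w)`-degree `≥ 3` — the cross term `ε̄₁·U_vU_w` of the initial form is untouched at
EVERY point of the line.
[folklore] -/
theorem tail_deg_ge_three_line (β₁ β₂ γ₁ γ₂ : ℤ) (hβ : 0 ≤ β₁ ∧ 0 ≤ β₂) (hb : 2 ≤ β₁ + β₂)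
    (hγ : min 1 β₁ + 1 ≤ γ₁ ∧ min 1 β₂ + 1 ≤ γ₂) : 3 ≤ γ₁ + γ₂ := by
  omega

/-- **THE CROSS-TERM LEMMA, coefficient level** [g23; KERNEL (PROVED)] (ODD LEMMA Z.C (v), the one place where `2 ∈
κ×` is used): over a
field with `2 ≠ 0`, if `c·(a₀Z + a₁U₁ + a₂U₂ + a₃U₃)²` has `Z²`-coefficient `c·a₀² = Q̄ ≠ 0` and NO `Z·U_i` terms
(`2c·a₀·a_i = 0`), then
`a₁ = a₂ = a₃ = 0`, i.e. its `U`-part vanishes.  Contrapositively: an initial form `Q̄Z² + q(U)` with `q ≠ 0` (and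
no `Z·U` terms) is NOT a
multiple of the square of a linear form — `τ ≥ 2`.  In residue characteristic `2` this fails (`Z² + U₁U₂… ` vs `(Z +
U₁)² = Z² + U₁²`: the
parity calculus of (X**) is exactly about which `q` are squares). [folklore] -/
theorem crossTerm_coeff {K : Type} [Field K] (h2 : (2 : K) ≠ 0) {c a₀ a₁ a₂ a₃ Q : K} (hQ : Q ≠ 0)
    (hZZ : c * a₀ ^ 2 = Q) (h₁ : 2 * c * a₀ * a₁ = 0) (h₂' : 2 * c * a₀ * a₂ = 0) (h₃ : 2 * c * a₀ * a₃ = 0) :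
    a₁ = 0 ∧ a₂ = 0 ∧ a₃ = 0 := by
  have hc : c ≠ 0 := by rintro rfl; simp at hZZ; exact hQ hZZ.symm
  have ha : a₀ ≠ 0 := by rintro rfl; simp at hZZ; exact hQ hZZ.symm
  have hk : 2 * c * a₀ ≠ 0 := mul_ne_zero (mul_ne_zero h2 hc) ha
  exact ⟨(mul_eq_zero.mp h₁).resolve_left hk, (mul_eq_zero.mp h₂').resolve_left hk,
    (mul_eq_zero.mp h₃).resolve_left hk⟩

/-- The pattern `e_i + e_j` of LEMMA Y.C (iii) on integer exponent vectors (= `Theorems.DeepCrossCutFanGame.IsPair`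
of g22's kernel companion,
restated so that the odd reading below is stated over the same shapes).  DEFINITION (support). -/
def IsPairZ (x y z : ℤ) : Prop := (x = 0 ∧ y = 1 ∧ z = 1) ∨ (x = 1 ∧ y = 0 ∧ z = 1) ∨ (x = 1 ∧ y = 1 ∧ z = 0)

/-- **ODD READING OF THE (X**) STOP, lines** [g23; KERNEL (PROVED)] (ODD LEMMA Z.C (ii)): a TOP line (`|a|, |b| ≥
2`) that is NOT special in
the sense of g22's `FanGame.Special` (`2 ≤ |a| ∧ 2 ≤ |b| ∧ a ≠ (1,1) ∧ b ≠ (1,1)`) has a PAIR: `a = (1,1)` or `b =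
(1,1)` — its initial form
carries the cross term `U_v·U_w`. [folklore] -/
theorem oddReading_line (a₁ a₂ b₁ b₂ : ℤ) (htop : 2 ≤ a₁ + a₂ ∧ 2 ≤ b₁ + b₂)
    (hns : ¬ (2 ≤ a₁ + a₂ ∧ 2 ≤ b₁ + b₂ ∧ ¬ (a₁ = 1 ∧ a₂ = 1) ∧ ¬ (b₁ = 1 ∧ b₂ = 1))) :
    (a₁ = 1 ∧ a₂ = 1) ∨ (b₁ = 1 ∧ b₂ = 1) := by
  by_contra h
  push Not at h
  exact hns ⟨htop.1, htop.2, fun hh => (h.1 hh.1) hh.2 |>.elim, fun hh => (h.2 hh.1) hh.2 |>.elim⟩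

/-- **ODD-SPECIAL LINES ARE (X**)-SPECIAL** [g23; KERNEL (PROVED)] (ODD LEMMA Z.C (ii)): `|a|, |b| ≥ 3` (the odd `τ
= 1` lines) implies
g22's `Special` shape — the odd `τ = 1` locus is DOMINATED by the characteristic-`2` one, so nothing odd-special
survives the (X**) stop. [folklore] -/
theorem oddSpecial_line_is_special (a₁ a₂ b₁ b₂ : ℤ) (hodd : 3 ≤ a₁ + a₂ ∧ 3 ≤ b₁ + b₂) :
    2 ≤ a₁ + a₂ ∧ 2 ≤ b₁ + b₂ ∧ ¬ (a₁ = 1 ∧ a₂ = 1) ∧ ¬ (b₁ = 1 ∧ b₂ = 1) := by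
  omega

/-- **ODD READING OF THE (X**) STOP, cone origins** [g23; KERNEL (PROVED)] (ODD LEMMA Z.C (iii)): an order-`2` cone
origin (`|α|, |β| ≥ 2`)
that is NOT a special point in the sense of g22's `FanGame.IsSpecialCone` has a PAIR exponent `α` or `β ∈ {e_i +
e_j}` — cross term `U_i·U_j`.
[folklore] -/
theorem oddReading_point (α₁ α₂ α₃ β₁ β₂ β₃ : ℤ) (htop : 2 ≤ α₁ + α₂ + α₃ ∧ 2 ≤ β₁ + β₂ + β₃)
    (hns : ¬ (2 ≤ α₁ + α₂ + α₃ ∧ 2 ≤ β₁ + β₂ + β₃ ∧ ¬ IsPairZ α₁ α₂ α₃ ∧ ¬ IsPairZ β₁ β₂ β₃)) :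
    IsPairZ α₁ α₂ α₃ ∨ IsPairZ β₁ β₂ β₃ := by
  by_contra h
  push Not at h
  exact hns ⟨htop.1, htop.2, h.1, h.2⟩

/-- **ODD-SPECIAL POINTS ARE (X**)-SPECIAL** [g23; KERNEL (PROVED)] (ODD LEMMA Z.C (iii)): `|α|, |β| ≥ 3` implies
g22's `IsSpecialCone`
shape. [folklore] -/
theorem oddSpecial_point_is_special (α₁ α₂ α₃ β₁ β₂ β₃ : ℤ) (hodd : 3 ≤ α₁ + α₂ + α₃ ∧ 3 ≤ β₁ + β₂ + β₃) :
    2 ≤ α₁ + α₂ + α₃ ∧ 2 ≤ β₁ + β₂ + β₃ ∧ ¬ IsPairZ α₁ α₂ α₃ ∧ ¬ IsPairZ β₁ β₂ β₃ := by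
  unfold IsPairZ; omega

/-- **TAILS CANNOT TOUCH A PAIR MONOMIAL** [g23; KERNEL (PROVED)] (ODD LEMMA Z.C (v), with (T5) STEP 1: a tail
monomial `u^γ` of the
controlled transform has `γ_k ≥ min(α_k, β_k) + 1` for every ray `k`): if `α` is a pair then no tail exponent equals
`α` (at the coordinate
`k ∉ {i,j}`, `α_k = 0 < 1 ≤ γ_k`).  So the `U_iU_j`-coefficient of the initial form is the bed's `ε̄·c̄^{…} ≠ 0`. [folklore] -/
theorem tail_ne_pair (α₁ α₂ α₃ β₁ β₂ β₃ γ₁ γ₂ γ₃ : ℤ) (hβ : 0 ≤ β₁ ∧ 0 ≤ β₂ ∧ 0 ≤ β₃)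
    (hγ : min α₁ β₁ + 1 ≤ γ₁ ∧ min α₂ β₂ + 1 ≤ γ₂ ∧ min α₃ β₃ + 1 ≤ γ₃) (hα : IsPairZ α₁ α₂ α₃) :
    ¬ (γ₁ = α₁ ∧ γ₂ = α₂ ∧ γ₃ = α₃) := by
  unfold IsPairZ at hα; omega

/-- **THE TWO BED MONOMIALS NEVER COINCIDE at a cone origin** [g23; KERNEL (PROVED)] (ODD LEMMA Z.C (v)): `α = β` on
a cone would make
`δ = a − b` vanish on three rays spanning `e_t`, i.e. `δ(e_t) = −2 = 0`.  Stated on the functional: `δ ≡ 0` on a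
basis is absurd. [folklore] -/
theorem deltaFun_not_zero_on_basis (m d : ℤ) (v w z : ℤ × ℤ × ℤ) (α β γ : ℤ)
    (hx : α * v.1 + β * w.1 + γ * z.1 = 0) (hy : α * v.2.1 + β * w.2.1 + γ * z.2.1 = 0)
    (ht : α * v.2.2 + β * w.2.2 + γ * z.2.2 = 1) :
    ¬ (deltaFun m d v = 0 ∧ deltaFun m d w = 0 ∧ deltaFun m d z = 0) := by
  rintro ⟨hv, hw, hz⟩
  have h := dvd_two_of_dvd_deltaFun m d 0 v w z α β γ hx hy ht (by rw [hv]) (by rw [hw]) (by rw [hz])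
  omega

section OddInhabitant

open MvPolynomial

/-- **THE `𝔽₃` INHABITANT OF WINDOW (d‴)** [critic row 175; g23]: `f₃ = z² + u₁⁵ + v²·u₂⁷ ∈ 𝔽₃[z, u₁, u₂, v]`
(variables `0,1,2,3` = the
frame `(z, u₁, u₂, v)`) — the support of INSEP-vv7 read over `𝔽₃`.  DEFINITION (support, the bed member). [folklore] -/
noncomputable def oddX3f : MvPolynomial (Fin 4) (ZMod 3) := X 0 ^ 2 + X 1 ^ 5 + X 3 ^ 2 * X 2 ^ 7

end OddInhabitant

end OddRing

end Summit.ResolutionOfSingularities.ResolutionOfSingularities.Theorems.OddCrossCut
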